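import Literature.NumberTheory.EllipticCurves.ZpExtensionGaloisTwistLocal
import Literature.NumberTheory.EllipticCurves.SelmerInftyTorsionPowKummerLiftProofs
import Literature.NumberTheory.GaloisRepresentations.ContinuousH1OrderTwo
import HarnessLib

/-!
# Local descent for the twisted module where the twist is locally invisible — in particular at the
# ARCHIMEDEAN places: every local class of `H¹((K_∞)_w, E)` coming from `H¹(K_∞, E[p^∞])` is the image
# of a level-`K` class of `H¹(Γ_{K_w}, E[p^J](χ_u))` (proofs only)

Topic `Literature/NumberTheory/EllipticCurves`; PROOFS file (theorems only; no definition, no named fact,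
no instance; D-0026) on top of `ZpExtensionGaloisTwistLocal` (the local map `twistedTorsionToLocalH1` and
its square) and `SelmerInftyTorsionPowKummerLiftProofs` (Kummer lift at level `p^J`).

Greenberg (LNM 1716, §4 p. 109): «For archimedean `v`, one easily verifies that
`𝒫_E^{(v)}(F) ≅ 𝒫_E^{(v)}(F_∞)^Γ`.» In the twisted Poitou–Tate lifting (cell `bsd-2adic`,
HOME/t42/DESIGN-T42-ADDENDUM-16.md brick (γ_∞)) this is the statement that the local datum at a real place
can be prescribed at level `K`: for a completion `E = K_v` whose Galois group maps into `Gal(K̄/K_∞)` —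
every ARCHIMEDEAN completion does, since `Γ_{K_w}` has order `≤ 2` and `Gal(K_∞/K) ≅ ℤ_p` is torsion-free
(`ZpExtension.resGal_mem_kerSubgroup_of_infinitePlace`) — and every class `c ∈ H¹(K_∞, E[p^∞])` killed by
`p^J`, there is a class `t ∈ H¹(Γ_E, E[p^J](χ_u))` with
`twistedTorsionToLocalH1 t = localResOver_E c` (`WeierstrassCurve.exists_twistedTorsionToLocalH1_eq_localResOver`;
archimedean form `…_infinitePlace`). Proof: lift `c` to `H¹(K_∞, E[p^J])` (Kummer, `p558517`'s
`exists_torsionPowToPrimaryH1Sub_eq`) and compose the lifted cocycle with `Γ_E → Gal(K̄/K_∞)`; the twist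
is invisible on the image.

References: R. Greenberg, *Iwasawa theory for elliptic curves*, LNM 1716 (1999), §4 pp. 106–109, 124
[GreenbergLNM1716]; J.-P. Serre, *Galois Cohomology* (1997), I §2.4, II §1.1 [SerreGaloisCohomology1997].
-/

noncomputable section

open CategoryTheory Field
open scoped ContRepresentation

universe u

namespace Literature.NumberTheory.EllipticCurves.ZpExtension

open Literature.NumberTheory.GaloisRepresentations

variable {K : Type u} [Field K] {p : ℕ} [Fact p.Prime] (κ : ZpExtension K p)

/-- **An archimedean local Galois group maps into `Gal(K̄/K_∞)`**: for an infinite place `w` of `K` and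
`σ ∈ Γ_{K_w}` (a group of order `≤ 2`, tree `natCard_absoluteGaloisGroup_completion_infinitePlace_le_two`),
`κ(σ|_{K̄}) = 0` since `2·κ(σ|_{K̄}) = κ(σ²|_{K̄}) = 0` in the torsion-free `ℤ_p`. (Every infinite place
splits completely in a `ℤ_p`-extension.) [cite: Washington1997, §13.1] -/
theorem resGal_mem_kerSubgroup_of_infinitePlace (w : NumberField.InfinitePlace K)
    (σ : absoluteGaloisGroup w.Completion) : resGal (K := K) w.Completion σ ∈ κ.kerSubgroup := by
  haveI := finite_absoluteGaloisGroup_completion_infinitePlace w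
  have hσ : σ * σ = 1 :=
    mul_self_eq_one_of_natCard_le_two (natCard_absoluteGaloisGroup_completion_infinitePlace_le_two w) σ
  rw [ZpExtension.mem_kerSubgroup]
  have h2 : κ (resGal (K := K) w.Completion σ) * κ (resGal (K := K) w.Completion σ) = 1 := by
    rw [← map_mul, ← map_mul, hσ, map_one, map_one]
  apply Multiplicative.toAdd.injective
  rw [toAdd_one]
  have h3 : (κ (resGal (K := K) w.Completion σ)).toAdd + (κ (resGal (K := K) w.Completion σ)).toAdd = 0 := by
    rw [← toAdd_mul, h2, toAdd_one]
  exact add_self_eq_zero.mp h3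

end Literature.NumberTheory.EllipticCurves.ZpExtension

namespace WeierstrassCurve

open Literature.NumberTheory.EllipticCurves Literature.NumberTheory.GaloisRepresentations

variable {K : Type u} [Field K] (W : WeierstrassCurve K) (p : ℕ) [Fact p.Prime]
  (κ : ZpExtension K p) (J : ℕ) (u : ℤ) (hu : (p : ℤ) ∣ u - 1)
  (E : Type u) [Field E] [Algebra K E]

/-- **Local descent where the twist is invisible.** Let `E` be a completion (any `K`-algebra that is a
field) whose absolute Galois group maps into `Gal(K̄/K_∞)` (`hE`). Then every class `c ∈ H¹(K_∞, E[p^∞])`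
killed by `p^J` has its local restriction `localResOver_E c ∈ H¹(Γ_E ∩ ·, E(K̄_E))` in the image of the
level-`K` group `H¹(Γ_E, E[p^J](χ_u))` under `twistedTorsionToLocalH1`: lift `c = ι_*[g]` with `g` valued in
`E[p^J]` (Kummer) and take `t = [σ ↦ g(σ|_{K̄})]`, a cocycle for the twisted module because `χ_u` is trivial
on `Gal(K̄/K_∞)`. [cite: GreenbergLNM1716, §4 pp. 106–109] [cite: SerreGaloisCohomology1997, I §2.4] -/
theorem exists_twistedTorsionToLocalH1_eq_localResOver [W.IsElliptic]
    (hdiv : W.zsmul_geomPoints_surjective)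
    (hE : ∀ σ : absoluteGaloisGroup E, resGal (K := K) E σ ∈ κ.kerSubgroup)
    (c : W.subgroupH1 p κ.kerSubgroup) (hc : p ^ J • c = 0) :
    ∃ t : galoisCohomology ((W.twistedTorsionGaloisModule p κ J u hu).restrictField E) 1,
      W.twistedTorsionToLocalH1 p κ J u hu E t = W.localResOver p κ.kerSubgroup E c := by
  obtain ⟨y, rfl⟩ := W.exists_torsionPowToPrimaryH1Sub_eq p κ.kerSubgroup J hdiv hc
  obtain ⟨g, rfl⟩ := oneCocycleClass_surjective _ y
  -- the cocycle `σ ↦ g(σ|_{K̄})` for the twisted module restricted to `Γ_E`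
  let r : absoluteGaloisGroup E → κ.kerSubgroup := fun σ ↦ ⟨resGal (K := K) E σ, hE σ⟩
  have hr : Continuous r := (resGal (K := K) E).continuous.subtype_mk _
  have hrmul : ∀ σ τ, r (σ * τ) = r σ * r τ := fun σ τ ↦ Subtype.ext (map_mul _ σ τ)
  let ξ : contOneCocycles ((W.twistedTorsionGaloisModule p κ J u hu).restrictField E).toTopRep :=
    ⟨⟨fun σ ↦ g.1 (r σ), g.1.continuous.comp hr⟩, fun σ τ ↦ by
      change g.1 (r (σ * τ)) = g.1 (r σ) +
        W.twistedTorsionGaloisModule p κ J u hu (resGal (K := K) E σ) (g.1 (r τ))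
      rw [hrmul, g.2 (r σ) (r τ),
        ZpExtension.galoisTwist_apply_of_mem_kerSubgroup _ _ _ _ _ _ (hE σ),
        torsionGaloisModule_apply_apply]
      rfl⟩
  refine ⟨oneCocycleClass _ ξ, ?_⟩
  rw [twistedTorsionToLocalH1_oneCocycleClass, resH1Hom_inclusion_oneCocycleClass,
    localResOver_kerSubgroup_oneCocycleClass]
  congr 1

/-- **The archimedean case (Greenberg p. 109: «for archimedean `v` one easily verifies
`𝒫^{(v)}(F) ≅ 𝒫^{(v)}(F_∞)^Γ`»).** For an infinite place `w` of a number field `K` and every class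
`c ∈ H¹(K_∞, E[p^∞])` killed by `p^J`, there is `t ∈ H¹(Γ_{K_w}, E[p^J](χ_u))` with
`twistedTorsionToLocalH1 t = localResOver_w c` — the local datum at `w` of the generic lifting `LIFT₁`
(`Summits/…/ByReductionTypeAtTwoMultTransportTwistedDescentSingle.lean`) can be prescribed at level `K`.
[cite: GreenbergLNM1716, §4 pp. 106–109] -/
theorem exists_twistedTorsionToLocalH1_eq_localResOver_infinitePlace [NumberField K] [W.IsElliptic]
    (hdiv : W.zsmul_geomPoints_surjective) (w : NumberField.InfinitePlace K)
    (c : W.subgroupH1 p κ.kerSubgroup) (hc : p ^ J • c = 0) :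
    ∃ t : galoisCohomology ((W.twistedTorsionGaloisModule p κ J u hu).restrictField w.Completion) 1,
      W.twistedTorsionToLocalH1 p κ J u hu w.Completion t =
        W.localResOver p κ.kerSubgroup w.Completion c :=
  W.exists_twistedTorsionToLocalH1_eq_localResOver p κ J u hu w.Completion hdiv
    (κ.resGal_mem_kerSubgroup_of_infinitePlace w) c hc

end WeierstrassCurve

end
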